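import Literature.AnabelianGeometry.SemiGraphs.ProSigmaCompletionExtend
import HarnessLib

/-!
# Pro-`Σ` completions of discrete groups, III: restriction to an open subgroup

Continuation of `ProSigmaCompletionQuotients.lean` / `ProSigmaCompletionExtend.lean` over
abc-iut-L3-t1's interface `SemiGraphOfAnabelioids.IsProSigmaCompletion Sigma ι` ([SemiAnbd]
Example 2.10, "the maximal pro-`Σ` quotient of the fundamental group of a hyperbolic Riemann surface
of finite type", p. 31) [cite: MochizukiSemiAnbd2006, Ex. 2.10 p.31].  Theorems only, no
definitions (abc-iut cell, layer L3, piece (GT-B) of row W4-11 «surface type is stable under finite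
étale coverings»: the Galois side of [SemiAnbd] Example 2.10 / Remark 2.4.1 needs that the open
point-stabiliser `Π_{v'} ≤ Π_v` of a finite étale covering is again the pro-`Σ` completion of ITS
discrete fundamental group `ι⁻¹(Π_{v'})`).

**Main result** (`IsProSigmaCompletion.restrict`).  Let `ι : Γ → P` exhibit the profinite group `P`
as the pro-`Σ` completion of `Γ` and let `H ⊆ P` be an OPEN subgroup.  Then the restriction
`ι| : ι⁻¹(H) → H` (Mathlib `MonoidHom.subgroupComap`) exhibits `H` as the pro-`Σ` completion of
`ι⁻¹(H)`:

* (dense) `ι(ι⁻¹ H)` is dense in `H` — because `H` is open and `ι(Γ)` is dense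
  (`dense_range_subgroupComap`);
* (pro-`Σ`) open subgroups of `H` have `Σ`-integer index in `H` — an open subgroup `N ⊆ H` is open
  in `P`, so `[P : N] = [H : N]·[P : H]` is a `Σ`-integer by part I (`isSigmaInteger_index`), and
  `Σ`-integers are closed under divisors (`isSigmaInteger_index_of_isOpen`);
* (universality) every normal subgroup `N ⊴ ι⁻¹(H)` of `Σ`-integer index is the pull-back of an open
  subgroup of `H` — by part II (`exists_continuous_extend`) the finite `Σ`-quotient
  `ι⁻¹(H) ↠ ι⁻¹(H)/N` extends to a CONTINUOUS homomorphism `F : H → ι⁻¹(H)/N`, whose kernel is the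
  required open subgroup (`exists_isOpen_comap_subgroupComap_eq`).

No statement here takes a side on [IUTchIII] Cor. 3.12; this is plain (pro)finite group theory.
-/

namespace Literature.AnabelianGeometry.SemiGraphs.SemiGraphOfAnabelioids.IsProSigmaCompletion

open Literature.AnabelianGeometry.Anabelioids Topology

variable {Sigma : Set ℕ} {Γ : Type*} [Group Γ] {P : Type*} [Group P] [TopologicalSpace P]
  {ι : Γ →* P}

/-! ### Density of `ι(ι⁻¹ H)` in an open subgroup `H` -/

omit [TopologicalSpace P] in
/-- The restriction `ι| : ι⁻¹(H) → H` is `γ ↦ ι γ` on underlying elements.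
[cite: MochizukiSemiAnbd2006, Ex. 2.10 p.31] -/
theorem subgroupComap_apply_coe (H : Subgroup P) (x : H.comap ι) :
    ((ι.subgroupComap H x : H) : P) = ι x := rfl

/-- For an open subgroup `H ⊆ P`, the image of `ι⁻¹(H)` under `ι| : ι⁻¹(H) → H` is dense in `H`
(`H` is open and `ι(Γ)` is dense in `P`). [cite: MochizukiSemiAnbd2006, Ex. 2.10 p.31] -/
theorem dense_range_subgroupComap (hι : IsProSigmaCompletion Sigma ι) (H : Subgroup P)
    (hH : IsOpen (H : Set P)) : Dense (Set.range (ι.subgroupComap H)) := by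
  intro x
  rw [IsInducing.subtypeVal.closure_eq_preimage_closure_image, Set.mem_preimage]
  have hx : (x : P) ∈ closure ((H : Set P) ∩ Set.range ι) :=
    hι.dense.open_subset_closure_inter hH x.2
  refine closure_mono ?_ hx
  rintro _ ⟨hyH, ⟨γ, rfl⟩⟩
  exact ⟨⟨ι γ, hyH⟩, ⟨⟨γ, hyH⟩, rfl⟩, rfl⟩

/-! ### Open subgroups of `H` have `Σ`-integer index -/

omit [TopologicalSpace P] in
/-- The image in `P` of a subgroup `N ⊆ H` under the inclusion is `N` as a set of elements of `P`.
[cite: MochizukiSemiAnbd2006, Ex. 2.10 p.31] -/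
theorem coe_map_subtype (H : Subgroup P) (N : Subgroup H) :
    ((N.map H.subtype : Subgroup P) : Set P) = Subtype.val '' (N : Set H) := by
  ext x
  simp only [Subgroup.coe_map, Set.mem_image, SetLike.mem_coe]
  rfl

/-- A subgroup `N ⊆ H` that is open in the open subgroup `H` is open in `P`.
[cite: MochizukiSemiAnbd2006, Ex. 2.10 p.31] -/
theorem isOpen_map_subtype (H : Subgroup P) (hH : IsOpen (H : Set P)) (N : Subgroup H)
    (hN : IsOpen (N : Set H)) : IsOpen ((N.map H.subtype : Subgroup P) : Set P) := by
  rw [coe_map_subtype]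
  exact hH.isOpenMap_subtype_val _ hN

section Profinite

variable [IsTopologicalGroup P] [CompactSpace P] [TotallyDisconnectedSpace P]

/-- **Pro-`Σ`-ness passes to open subgroups.**  For `P` the (profinite) pro-`Σ` completion of `Γ` and
`H ⊆ P` open, every open subgroup `N ⊆ H` has `Σ`-integer index in `H`: indeed
`[P : N] = [H : N]·[P : H]` is a `Σ`-integer. [cite: MochizukiSemiAnbd2006, Ex. 2.10 p.31] -/
theorem isSigmaInteger_index_of_isOpen (hι : IsProSigmaCompletion Sigma ι) (H : Subgroup P)
    (hH : IsOpen (H : Set P)) (N : Subgroup H) (hN : IsOpen (N : Set H)) :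
    IsSigmaInteger Sigma N.index := by
  have h := isSigmaInteger_index hι (N.map H.subtype) (isOpen_map_subtype H hH N hN)
  rw [Subgroup.index_map_subtype] at h
  exact h.of_dvd (Dvd.intro _ rfl)

/-! ### Universality: finite `Σ`-quotients of `ι⁻¹(H)` come from open subgroups of `H` -/

/-- **Universality of `ι| : ι⁻¹(H) → H`.**  For `H ⊆ P` open and `N ⊴ ι⁻¹(H)` a normal subgroup of
`Σ`-integer index there is an open subgroup `U ⊆ H` with `(ι|)⁻¹(U) = N`: the finite `Σ`-quotient
`ι⁻¹(H) ↠ ι⁻¹(H)/N` extends to a continuous homomorphism `F : H → ι⁻¹(H)/N` along `ι`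
(`exists_continuous_extend`), and `U := Ker F`. [cite: MochizukiSemiAnbd2006, Ex. 2.10 p.31] -/
theorem exists_isOpen_comap_subgroupComap_eq (hι : IsProSigmaCompletion Sigma ι) (H : Subgroup P)
    (hH : IsOpen (H : Set P)) (N : Subgroup (H.comap ι)) [hNn : N.Normal]
    (hN : IsSigmaInteger Sigma N.index) :
    ∃ U : Subgroup H, IsOpen (U : Set H) ∧ U.comap (ι.subgroupComap H) = N := by
  classical
  letI : TopologicalSpace ((H.comap ι) ⧸ N) := ⊥
  haveI : DiscreteTopology ((H.comap ι) ⧸ N) := ⟨rfl⟩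
  haveI : N.FiniteIndex := ⟨hN.1.ne'⟩
  have hQ : IsSigmaInteger Sigma (Nat.card ((H.comap ι) ⧸ N)) := by
    rwa [← Subgroup.index_eq_card]
  obtain ⟨F, hFc, hF⟩ := exists_continuous_extend hι H hH hQ (QuotientGroup.mk' N)
  refine ⟨F.ker, ?_, ?_⟩
  · have hker : (F.ker : Set H) = F ⁻¹' {1} := by
      ext x
      simp only [SetLike.mem_coe, MonoidHom.mem_ker, Set.mem_preimage, Set.mem_singleton_iff]
    rw [hker]
    exact (isOpen_discrete _).preimage hFc
  · ext x
    obtain ⟨γ, hγ⟩ := x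
    rw [Subgroup.mem_comap, MonoidHom.mem_ker]
    change F ⟨ι γ, hγ⟩ = 1 ↔ _
    rw [hF γ hγ, QuotientGroup.mk'_apply, QuotientGroup.eq_one_iff]

/-- **[SemiAnbd] Example 2.10 / Remark 2.4.1, pro-`Σ` completions restrict to open subgroups.**  Let
`ι : Γ → P` exhibit the profinite group `P` as the pro-`Σ` completion of the discrete group `Γ`
(`IsProSigmaCompletion Sigma ι`) and let `H ⊆ P` be an open subgroup.  Then the restriction
`ι| : ι⁻¹(H) → H` (`MonoidHom.subgroupComap`) exhibits `H` as the pro-`Σ` completion of `ι⁻¹(H)`: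
dense image, open subgroups of `H` of `Σ`-integer index, and every normal `Σ`-index subgroup of
`ι⁻¹(H)` is the pull-back of an open subgroup of `H`.  (Consumed by the W4-11 assembly «semi-graphs of
anabelioids of surface type are stable under finite étale coverings», where `H = Π_{v'}` is the open
point-stabiliser in `Π_v`.) [cite: MochizukiSemiAnbd2006, Ex. 2.10 p.31] -/
theorem restrict (hι : IsProSigmaCompletion Sigma ι) (H : Subgroup P) (hH : IsOpen (H : Set P)) :
    IsProSigmaCompletion Sigma (ι.subgroupComap H) where
  dense := dense_range_subgroupComap hι H hH
  index_open N _ hN := isSigmaInteger_index_of_isOpen hι H hH N hN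
  comap_surj N hNn hN := by
    haveI := hNn
    exact exists_isOpen_comap_subgroupComap_eq hι H hH N hN

/-- The same for an open subgroup packaged as `H : OpenSubgroup P`.
[cite: MochizukiSemiAnbd2006, Ex. 2.10 p.31] -/
theorem restrict_openSubgroup (hι : IsProSigmaCompletion Sigma ι) (H : OpenSubgroup P) :
    IsProSigmaCompletion Sigma (ι.subgroupComap (H : Subgroup P)) :=
  restrict hι (H : Subgroup P) H.isOpen

/-- The same for an open NORMAL subgroup `N : OpenNormalSubgroup P` (the case of a Galois finite
étale covering). [cite: MochizukiSemiAnbd2006, Ex. 2.10 p.31] -/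
theorem restrict_openNormalSubgroup (hι : IsProSigmaCompletion Sigma ι) (N : OpenNormalSubgroup P) :
    IsProSigmaCompletion Sigma (ι.subgroupComap (N : Subgroup P)) :=
  restrict hι (N : Subgroup P) N.isOpen'

end Profinite

/-! ### Transport along an isomorphism of the discrete group; the form consumed with (GT-A) -/

omit [TopologicalSpace P] in
/-- Pulling a subgroup back along `ι ∘ e` is pulling back along `ι` and then along `e`.
[cite: MochizukiSemiAnbd2006, Ex. 2.10 p.31] -/
theorem comap_comp_mulEquiv {Γ' : Type*} [Group Γ'] (e : Γ' ≃* Γ) (U : Subgroup P) :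
    U.comap (ι.comp e.toMonoidHom) = (U.comap ι).comap e.toMonoidHom := rfl

/-- **Transport of `IsProSigmaCompletion` along an isomorphism of the discrete group.**  If
`ι : Γ → P` is a pro-`Σ` completion and `e : Γ' ≃* Γ`, then so is any `ι' : Γ' → P` with
`ι' = ι ∘ e` (pointwise).  (Dense image is unchanged; a normal `Σ`-index `N' ⊴ Γ'` is `e⁻¹(N)` for the
normal `Σ`-index `N = e(N') ⊴ Γ`.) [cite: MochizukiSemiAnbd2006, Ex. 2.10 p.31] -/
theorem of_comp_mulEquiv {Γ' : Type*} [Group Γ'] {ι' : Γ' →* P} (e : Γ' ≃* Γ)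
    (he : ∀ x, ι (e x) = ι' x) (hι : IsProSigmaCompletion Sigma ι) :
    IsProSigmaCompletion Sigma ι' where
  dense := by
    have hr : Set.range ι' = Set.range ι := by
      ext y
      constructor
      · rintro ⟨x, rfl⟩
        exact ⟨e x, he x⟩
      · rintro ⟨x, rfl⟩
        exact ⟨e.symm x, by rw [← he, e.apply_symm_apply]⟩
    rw [hr]
    exact hι.dense
  index_open := hι.index_open
  comap_surj N hNn hN := by
    -- `N ⊴ Γ'` of `Σ`-index corresponds to `e(N) ⊴ Γ` of the same index
    have hmap : N.map e.toMonoidHom = N.comap e.symm.toMonoidHom := by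
      ext x
      simp only [Subgroup.mem_map, MulEquiv.coe_toMonoidHom, Subgroup.mem_comap]
      constructor
      · rintro ⟨y, hy, rfl⟩
        rwa [e.symm_apply_apply]
      · intro hx
        exact ⟨e.symm x, hx, e.apply_symm_apply x⟩
    haveI : (N.map e.toMonoidHom).Normal := by
      rw [hmap]
      exact Subgroup.Normal.comap hNn _
    have hidx : (N.map e.toMonoidHom).index = N.index :=
      Subgroup.index_map_eq N e.surjective (by
        rw [e.toMonoidHom.ker_eq_bot_iff.mpr e.injective]; exact bot_le)
    obtain ⟨U, hUo, hU⟩ := hι.comap_surj (N.map e.toMonoidHom) inferInstance (hidx ▸ hN)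
    refine ⟨U, hUo, ?_⟩
    ext x
    rw [Subgroup.mem_comap, ← he x]
    change ι (e.toMonoidHom x) ∈ U ↔ _
    rw [← Subgroup.mem_comap, hU, hmap, Subgroup.mem_comap]
    simp

section Profinite

variable [IsTopologicalGroup P] [CompactSpace P] [TotallyDisconnectedSpace P]

/-- **The form consumed together with (GT-A).**  Let `ι : Γ → P` be a pro-`Σ` completion (`P`
profinite), `H ⊆ P` open, and `θ : Γ' → Γ` an INJECTIVE homomorphism with image exactly `ι⁻¹(H)` (for
[SemiAnbd] Example 2.10: `Γ = Γ_{g,r}`, `H = Π_{v'}` the open point-stabiliser of a finite étale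
covering, `θ : Γ_{g',r'} ⥲ ι⁻¹(Π_{v'})` from the finite-index-subgroup theorem).  Then
`ι ∘ θ : Γ' → H` exhibits `H` as the pro-`Σ` completion of `Γ'`.
[cite: MochizukiSemiAnbd2006, Ex. 2.10 p.31] -/
theorem restrict_comp_of_range_eq (hι : IsProSigmaCompletion Sigma ι) (H : Subgroup P)
    (hH : IsOpen (H : Set P)) {Γ' : Type*} [Group Γ'] (θ : Γ' →* Γ) (hθ : Function.Injective θ)
    (hθr : θ.range = H.comap ι) (hmem : ∀ x, ι (θ x) ∈ H) :
    IsProSigmaCompletion Sigma ((ι.comp θ).codRestrict H hmem) := by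
  -- `θ` co-restricts to an isomorphism `e : Γ' ≃* ι⁻¹(H)`
  let θ' : Γ' →* H.comap ι := θ.codRestrict (H.comap ι) fun x => hθr ▸ ⟨x, rfl⟩
  have hθ'b : Function.Bijective θ' := by
    constructor
    · intro x y hxy
      exact hθ (congrArg (fun z : H.comap ι => (z : Γ)) hxy)
    · rintro ⟨y, hy⟩
      rw [← hθr] at hy
      obtain ⟨x, rfl⟩ := hy
      exact ⟨x, rfl⟩
  let e : Γ' ≃* H.comap ι := MulEquiv.ofBijective θ' hθ'b
  refine of_comp_mulEquiv e (fun x => ?_) (restrict hι H hH)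
  rfl

end Profinite

end Literature.AnabelianGeometry.SemiGraphs.SemiGraphOfAnabelioids.IsProSigmaCompletion
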